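import Summits.QuantumAdvantage.QuantumAdvantage.Theorems.CertDialF
import Summits.QuantumAdvantage.QuantumAdvantage.Theorems.RingDeck
import Summits.QuantumAdvantage.AdviceFreeQNC0.RingRotation
import HarnessLib

/-!
# CutDial (A) — decomp-qadv lens-2 (structural dichotomy: special vs generic), generation 31, part 1/3

TARGET (by name): `Theses.ExactnessDial.NoPerfectTwo3` (stmt-QuantumAdvantage-27432): «eventually in `n`, no `𝔽₃`-degree-`≤ 2`
strategy of the cyclic ring game (`RingHLF.Rel`) is perfect on the odd class».

THE DIAL OF THIS NODE is the CUT-CROSSING STRUCTURE of a strategy: which outputs may read which inputs ACROSS A BIPARTITION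
`(S, Sᶜ)` of the ring positions.  Its bottom notch — BIPARTITE-LOCAL strategy maps (`BiLocal S z`: the outputs on `S` read only the
inputs on `S`, the outputs off `S` only the inputs off `S`; NO degree bound, NO geometry) — is KILLED in parts A/B by an engine new
to the cell: a `3 × 3` PARITY CERTIFICATE, a Peres–Mermin «magic square» for the ring cluster state across a cut (`magic_of_square`).

THE MAGIC SQUARE (`magic_of_square`, abstract form).  Nine inputs `x i j` (`i, j < 3`) with explicit kernel vectors `v i j` and
signs `sg i j ∈ 𝔽₂` such that: the inputs of a column `j` agree on `S` and the inputs of a row `i` agree off `S`; COLUMN LAW — at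
every position of `S` the three vectors of each column have even sum; ROW LAW — at every position off `S` the three vectors of
each row have even sum; SIGN LAW — the nine signs sum to `1`.  A bipartite-local `z` answers a position of `S` as a function of
the column only and a position off `S` as a function of the row only, so the nine winning equations `⟨v i j, z (x i j)⟩ = sg i j`
(`dz_eq_of_rel`) sum, position by position, to `0 = 1`.
Part A instantiates it for ODD `n ≥ 7` (`magicO`): in the frame where `0,1,2 ∉ S` and `3,4,5 ∈ S` (`Faces33At m S`, any rotation `m`), the inputs
`xO n i j` put the domino `i` on `{0,1,2}` (`∅ / {1,2} / {0,1}`) and the domino `j` on `{3,4,5}` (`∅ / {4,5} / {3,4}`); the kernel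
vectors `vO n i j` are alternating or full beyond position `6` with phase `(i + j) mod 3`; only the all-zero cell has sign `1`.
Part B: even `n`, all `n`; part C: the pieces over `NoPerfectTwo3` and `closes`.  Tree reuse (no restatement): the kernel
equation over `= true` atoms is `CertDial.xor_xor_and_eq_false_iff` (CertDialF), rotation invariance of the odd class is
`RingMinor.oddZeros_rot` (RingDeck), the rotation API is `AdviceFreeQNC0.RingSymmetry` (RingRotation).
-/

set_option linter.dupNamespace false
set_option linter.style.longLine false
set_option linter.unusedSimpArgs false
set_option linter.unusedTactic false
set_option linter.unreachableTactic false
set_option linter.unnecessarySeqFocus false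

namespace Summit.QuantumAdvantage.QuantumAdvantage.Theorems.CutDial
open Finset
open Literature.Computability.QuantumComplexity Literature.Computability.QuantumComplexity.RingHLF
open Summit.QuantumAdvantage.AdviceFreeQNC0 (OddZeros rot)
open Summit.QuantumAdvantage.AdviceFreeQNC0.LightConeWindowHard (prv_val nxt_val)
open Summit.QuantumAdvantage.QuantumAdvantage.Theorems.CertDial (dz dot2_eq_signBit_iff xor_xor_and_eq_false_iff)
open Summit.QuantumAdvantage.QuantumAdvantage.Theorems.RingMinor (oddZeros_rot)
open Summit.QuantumAdvantage.AdviceFreeQNC0.RingSymmetry (shift rot_apply inKernel_rot edgesIn_rot wtAnd_rot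
  card_filter_shift)

variable {n : ℕ}

/-! ## §1 Bipartite locality and the abstract magic square -/

/-- BIPARTITE LOCALITY of a strategy map `z` with respect to the position set `S`: the outputs on `S` depend only on the
inputs on `S`, and the outputs off `S` only on the inputs off `S` (no degree bound, no geometry). -/
def BiLocal (S : Finset (Fin n)) (z : (Fin n → Bool) → Fin n → Bool) : Prop :=
  (∀ x y : Fin n → Bool, (∀ b ∈ S, x b = y b) → ∀ b ∈ S, z x b = z y b) ∧
  (∀ x y : Fin n → Bool, (∀ b, b ∉ S → x b = y b) → ∀ b, b ∉ S → z x b = z y b)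

/-- the bipartition `(S, Sᶜ)` FACES `3|3` in the frame rotated by `m`: a position `b` with `(b + m) mod n ∈ {0,1,2}` lies OFF `S`
and one with `(b + m) mod n ∈ {3,4,5}` lies IN `S` — the cut is sharp at one window and `S` is arbitrary elsewhere. -/
def Faces33At (m : ℕ) (S : Finset (Fin n)) : Prop :=
  ∀ b : Fin n, ((shift n m b).val < 3 → b ∉ S) ∧ (3 ≤ (shift n m b).val → (shift n m b).val < 6 → b ∈ S)

/-- in the rotated frame a position of `S` reads `≥ 3`. -/
theorem Faces33At.three_le {m : ℕ} {S : Finset (Fin n)} (hS : Faces33At m S) {b : Fin n} (hb : b ∈ S) :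
    3 ≤ (shift n m b).val := by
  by_contra h; exact (hS b).1 (by omega) hb

/-- in the rotated frame a position off `S` reads `< 3` or `≥ 6`. -/
theorem Faces33At.off {m : ℕ} {S : Finset (Fin n)} (hS : Faces33At m S) {b : Fin n} (hb : b ∉ S) :
    (shift n m b).val < 3 ∨ 6 ≤ (shift n m b).val := by
  by_contra h; exact hb ((hS b).2 (by omega) (by omega))

/-- a position predicate that is membership of the value in an explicit set `T ⊆ [0,n)` has `|T|` solutions. -/
theorem card_filter_eq_of_iff (T : Finset ℕ) (hT : ∀ t ∈ T, t < n) (P : Fin n → Prop) [DecidablePred P]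
    (h : ∀ b : Fin n, P b ↔ b.val ∈ T) : (univ.filter P).card = T.card := by
  have e : univ.filter P = T.attachFin hT := by
    ext b; simp only [mem_filter, mem_univ, true_and, mem_attachFin, h]
  rw [e, card_attachFin]

/-- a position predicate that is NON-membership of the value in an explicit set `T ⊆ [0,n)` has `n − |T|` solutions. -/
theorem card_filter_eq_sub_of_iff (T : Finset ℕ) (hT : ∀ t ∈ T, t < n) (P : Fin n → Prop) [DecidablePred P]
    (h : ∀ b : Fin n, P b ↔ b.val ∉ T) : (univ.filter P).card = n - T.card := by
  have e : univ.filter P = univ \ T.attachFin hT := by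
    ext b; simp only [mem_filter, mem_univ, true_and, mem_sdiff, mem_attachFin, h]
  rw [e, card_sdiff_of_subset (subset_univ _), card_attachFin, card_univ, Fintype.card_fin]

/-- three bits of even parity, read as a Prop over `= true` atoms: `a ⊕ b ⊕ c = 0 ⟺ ((a ↔ b) ↔ ¬c)`. -/
theorem xor3_false_iff (a b c : Bool) :
    (xor (xor a b) c) = false ↔ ((a = true ↔ b = true) ↔ ¬ c = true) := by
  revert a b c; decide

/-- three bits of even parity have indicator sum `0` in `𝔽₂`. -/
theorem boolsum3 (a b c : Bool) (h : (xor (xor a b) c) = false) :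
    (if a = true then (1 : ZMod 2) else 0) + (if b = true then (1 : ZMod 2) else 0)
      + (if c = true then (1 : ZMod 2) else 0) = 0 := by
  revert h; revert a b c; decide

/-- using a winning answer against ONE explicit kernel vector: the parity equation, read in `𝔽₂`. -/
theorem dz_eq_of_rel {x V : Fin n → Bool} (hV : InKernel x V) {z : Fin n → Bool} (h : Rel x z) :
    dz V z = ((edgesIn V + wtAnd x V / 2 : ℕ) : ZMod 2) :=
  (dot2_eq_signBit_iff x V z).1 (h V hV)

/-- ★ THE ABSTRACT MAGIC SQUARE.  Nine inputs `x i j` with kernel vectors `v i j` and signs `sg i j` obeying the column / row / sign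
laws and the on-`S` / off-`S` agreement defeat every `S`-bipartite-local strategy map. -/
theorem magic_of_square {S : Finset (Fin n)} {z : (Fin n → Bool) → Fin n → Bool} (hz : BiLocal S z)
    (x v : ℕ → ℕ → Fin n → Bool) (sg : ℕ → ℕ → ZMod 2)
    (hk : ∀ i j, i < 3 → j < 3 → InKernel (x i j) (v i j))
    (hsg : ∀ i j, i < 3 → j < 3 → ((edgesIn (v i j) + wtAnd (x i j) (v i j) / 2 : ℕ) : ZMod 2) = sg i j)
    (hsum : (∑ i : Fin 3, ∑ j : Fin 3, sg i j) = 1)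
    (hcol : ∀ j, j < 3 → ∀ b ∈ S, (xor (xor (v 0 j b) (v 1 j b)) (v 2 j b)) = false)
    (hrow : ∀ i, i < 3 → ∀ b, b ∉ S → (xor (xor (v i 0 b) (v i 1 b)) (v i 2 b)) = false)
    (hon : ∀ i j, ∀ b ∈ S, x i j b = x 0 j b)
    (hoff : ∀ i j, ∀ b, b ∉ S → x i j b = x i 0 b) :
    ∃ i j : ℕ, i < 3 ∧ j < 3 ∧ ¬ Rel (x i j) (z (x i j)) := by
  by_contra hall
  simp only [not_exists, not_and, not_not] at hall
  have hwin : ∀ i j : Fin 3, dz (v i j) (z (x i j)) = sg i j := fun i j => by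
    rw [dz_eq_of_rel (hk i j i.isLt j.isLt) (hall i j i.isLt j.isLt)]; exact hsg i j i.isLt j.isLt
  -- the sum of the nine left-hand sides vanishes, position by position
  have hL : (∑ i : Fin 3, ∑ j : Fin 3, dz (v i j) (z (x i j))) = 0 := by
    calc (∑ i : Fin 3, ∑ j : Fin 3, dz (v i j) (z (x i j)))
        = ∑ i : Fin 3, ∑ b : Fin n, ∑ j : Fin 3, (if v i j b = true ∧ z (x i j) b = true then (1 : ZMod 2) else 0) := by
          unfold dz; exact Finset.sum_congr rfl fun i _ => Finset.sum_comm
      _ = ∑ b : Fin n, ∑ i : Fin 3, ∑ j : Fin 3, (if v i j b = true ∧ z (x i j) b = true then (1 : ZMod 2) else 0) :=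
          Finset.sum_comm
      _ = 0 := by
          refine Finset.sum_eq_zero fun b _ => ?_
          by_cases hb : b ∈ S
          · -- on `S` the answer bit depends on the column `j` only: factor it out of each column sum
            have hzj : ∀ i j : Fin 3, z (x i j) b = z (x 0 j) b := fun i j =>
              hz.1 _ _ (fun b' hb' => hon i j b' hb') b hb
            rw [Finset.sum_comm]
            refine Finset.sum_eq_zero fun j _ => ?_
            by_cases hzb : z (x 0 j) b = true
            · simp only [hzj, hzb, and_true, Fin.sum_univ_three, Fin.val_zero, Fin.val_one, Fin.val_two]
              exact boolsum3 _ _ _ (hcol j j.isLt b hb)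
            · simp only [hzj, hzb, Bool.false_eq_true, and_false, ↓reduceIte, Finset.sum_const_zero]
          · -- off `S` the answer bit depends on the row `i` only
            have hzi : ∀ i j : Fin 3, z (x i j) b = z (x i 0) b := fun i j =>
              hz.2 _ _ (fun b' hb' => hoff i j b' hb') b hb
            refine Finset.sum_eq_zero fun i _ => ?_
            by_cases hzb : z (x i 0) b = true
            · simp only [hzi, hzb, and_true, Fin.sum_univ_three, Fin.val_zero, Fin.val_one, Fin.val_two]
              exact boolsum3 _ _ _ (hrow i i.isLt b hb)
            · simp only [hzi, hzb, Bool.false_eq_true, and_false, ↓reduceIte, Finset.sum_const_zero]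
  have hS' : (∑ i : Fin 3, ∑ j : Fin 3, sg i j) = 0 :=
    (Finset.sum_congr rfl fun i _ => Finset.sum_congr rfl fun j _ => hwin i j).symm.trans hL
  rw [hsum] at hS'
  exact one_ne_zero hS'

/-! ## The odd-`n` magic square: inputs, kernel vectors, laws -/

/-- certificate input `(i, j)` for odd `n`: domino `i` on `{0,1,2}` (`i = 1 ↦ {1,2}`, `i = 2 ↦ {0,1}`), domino `j` on
`{3,4,5}` (`j = 1 ↦ {4,5}`, `j = 2 ↦ {3,4}`), zero elsewhere (an even number of ones). -/
def xO (n i j : ℕ) : Fin n → Bool := fun b =>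
  decide ((i = 1 ∧ (b.val = 1 ∨ b.val = 2)) ∨ (i = 2 ∧ (b.val = 0 ∨ b.val = 1)) ∨
    (j = 1 ∧ (b.val = 4 ∨ b.val = 5)) ∨ (j = 2 ∧ (b.val = 3 ∨ b.val = 4)))

/-- the explicit kernel vector of `xO n i j` (odd `n`): a window table on `{0,…,5}` and, from position `6` on, an
alternating or full pattern (phase `(i + j) mod 3`). -/
def vO (n i j : ℕ) : Fin n → Bool := fun b =>
  decide (i = 0 ∧ j = 0) ||
    decide (i = 0 ∧ j = 1 ∧ (b.val = 0 ∨ b.val = 2 ∨ b.val = 4 ∨ b.val = 5 ∨ (6 ≤ b.val ∧ b.val % 2 = 1))) ||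
    decide (i = 0 ∧ j = 2 ∧ (b.val = 1 ∨ b.val = 3 ∨ b.val = 4 ∨ (6 ≤ b.val ∧ b.val % 2 = 0))) ||
    decide (i = 1 ∧ j = 0 ∧ (b.val = 1 ∨ b.val = 2 ∨ b.val = 4 ∨ (6 ≤ b.val ∧ b.val % 2 = 0))) ||
    decide (i = 1 ∧ j = 1 ∧ (b.val = 0 ∨ b.val = 1 ∨ b.val = 3 ∨ b.val = 5 ∨ 6 ≤ b.val)) ||
    decide (i = 1 ∧ j = 2 ∧ (b.val = 0 ∨ b.val = 2 ∨ b.val = 3 ∨ b.val = 5 ∨ (6 ≤ b.val ∧ b.val % 2 = 1))) ||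
    decide (i = 2 ∧ j = 0 ∧ (b.val = 0 ∨ b.val = 1 ∨ b.val = 3 ∨ b.val = 5 ∨ (6 ≤ b.val ∧ b.val % 2 = 1))) ||
    decide (i = 2 ∧ j = 1 ∧ (b.val = 1 ∨ b.val = 2 ∨ b.val = 3 ∨ b.val = 4 ∨ (6 ≤ b.val ∧ b.val % 2 = 0))) ||
    decide (i = 2 ∧ j = 2 ∧ (b.val = 0 ∨ b.val = 2 ∨ b.val = 4 ∨ b.val = 5 ∨ 6 ≤ b.val))

/-- the sign table of the odd-`n` square (cells whose kernel vector has an odd `edgesIn + wtAnd / 2`). -/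
def sgO (i j : ℕ) : ZMod 2 := if (i = 0 ∧ j = 0) then 1 else 0

/-- `vO n i j` is a kernel vector of `xO n i j` (`n` odd, `n ≥ 7`). -/
theorem inKernel_vO (hn : 7 ≤ n) (h2 : n % 2 = 1) {i j : ℕ} (hi : i < 3) (hj : j < 3) : InKernel (xO n i j) (vO n i j) := by
  intro b
  rw [xor_xor_and_eq_false_iff]
  have hb := b.isLt
  interval_cases i <;> interval_cases j <;>
    simp only [xO, vO, Bool.or_eq_true, Bool.and_eq_true, decide_eq_true_eq, ne_eq, decide_eq_decide, prv_val, nxt_val, Nat.reduceEqDiff, mem_insert, mem_singleton, notMem_empty] <;>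
    first | omega | (split_ifs <;> (try simp only [false_or, or_false, false_and, and_false, true_or, or_true, true_and, and_true, not_false_eq_true, not_true_eq_false, iff_true, iff_false, true_iff, false_iff, not_true, if_true, if_false]) <;> omega)

/-- every `xO n i j` lies in the odd class (`n` odd, `n ≥ 7`). -/
theorem oddZeros_xO (hn : 7 ≤ n) (h2 : n % 2 = 1) {i j : ℕ} (hi : i < 3) (hj : j < 3) : OddZeros (xO n i j) := by
  unfold OddZeros
  have key : ∀ (T : Finset ℕ) (c : ℕ), (∀ t ∈ T, t < 6) → T.card = c → c < 7 → (c + 1) % 2 = n % 2 →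
      (∀ b : Fin n, xO n i j b = false ↔ b.val ∉ T) → (univ.filter fun b : Fin n => xO n i j b = false).card % 2 = 1 := by
    intro T c hT hc hc7 hpar h
    rw [card_filter_eq_sub_of_iff T (fun t ht => by have := hT t ht; omega) _ h, hc]
    omega
  interval_cases i <;> interval_cases j
  · exact key ∅ 0 (by simp) (by rfl) (by norm_num) (by omega) fun b => by
      have := b.isLt; simp only [xO, decide_eq_false_iff_not, decide_eq_true_eq, Nat.reduceEqDiff, mem_insert,
        mem_singleton, notMem_empty]; (try simp only [false_or, or_false, false_and, and_false, true_or, or_true, true_and, and_true, not_false_eq_true, not_true_eq_false, iff_true, iff_false, true_iff, false_iff, not_true, if_true, if_false]); all_goals omega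
  · exact key {4, 5} 2 (by simp) (by rfl) (by norm_num) (by omega) fun b => by
      have := b.isLt; simp only [xO, decide_eq_false_iff_not, decide_eq_true_eq, Nat.reduceEqDiff, mem_insert,
        mem_singleton, notMem_empty]; (try simp only [false_or, or_false, false_and, and_false, true_or, or_true, true_and, and_true, not_false_eq_true, not_true_eq_false, iff_true, iff_false, true_iff, false_iff, not_true, if_true, if_false]); all_goals omega
  · exact key {3, 4} 2 (by simp) (by rfl) (by norm_num) (by omega) fun b => by
      have := b.isLt; simp only [xO, decide_eq_false_iff_not, decide_eq_true_eq, Nat.reduceEqDiff, mem_insert,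
        mem_singleton, notMem_empty]; (try simp only [false_or, or_false, false_and, and_false, true_or, or_true, true_and, and_true, not_false_eq_true, not_true_eq_false, iff_true, iff_false, true_iff, false_iff, not_true, if_true, if_false]); all_goals omega
  · exact key {1, 2} 2 (by simp) (by rfl) (by norm_num) (by omega) fun b => by
      have := b.isLt; simp only [xO, decide_eq_false_iff_not, decide_eq_true_eq, Nat.reduceEqDiff, mem_insert,
        mem_singleton, notMem_empty]; (try simp only [false_or, or_false, false_and, and_false, true_or, or_true, true_and, and_true, not_false_eq_true, not_true_eq_false, iff_true, iff_false, true_iff, false_iff, not_true, if_true, if_false]); all_goals omega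
  · exact key {1, 2, 4, 5} 4 (by simp) (by rfl) (by norm_num) (by omega) fun b => by
      have := b.isLt; simp only [xO, decide_eq_false_iff_not, decide_eq_true_eq, Nat.reduceEqDiff, mem_insert,
        mem_singleton, notMem_empty]; (try simp only [false_or, or_false, false_and, and_false, true_or, or_true, true_and, and_true, not_false_eq_true, not_true_eq_false, iff_true, iff_false, true_iff, false_iff, not_true, if_true, if_false]); all_goals omega
  · exact key {1, 2, 3, 4} 4 (by simp) (by rfl) (by norm_num) (by omega) fun b => by
      have := b.isLt; simp only [xO, decide_eq_false_iff_not, decide_eq_true_eq, Nat.reduceEqDiff, mem_insert,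
        mem_singleton, notMem_empty]; (try simp only [false_or, or_false, false_and, and_false, true_or, or_true, true_and, and_true, not_false_eq_true, not_true_eq_false, iff_true, iff_false, true_iff, false_iff, not_true, if_true, if_false]); all_goals omega
  · exact key {0, 1} 2 (by simp) (by rfl) (by norm_num) (by omega) fun b => by
      have := b.isLt; simp only [xO, decide_eq_false_iff_not, decide_eq_true_eq, Nat.reduceEqDiff, mem_insert,
        mem_singleton, notMem_empty]; (try simp only [false_or, or_false, false_and, and_false, true_or, or_true, true_and, and_true, not_false_eq_true, not_true_eq_false, iff_true, iff_false, true_iff, false_iff, not_true, if_true, if_false]); all_goals omega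
  · exact key {0, 1, 4, 5} 4 (by simp) (by rfl) (by norm_num) (by omega) fun b => by
      have := b.isLt; simp only [xO, decide_eq_false_iff_not, decide_eq_true_eq, Nat.reduceEqDiff, mem_insert,
        mem_singleton, notMem_empty]; (try simp only [false_or, or_false, false_and, and_false, true_or, or_true, true_and, and_true, not_false_eq_true, not_true_eq_false, iff_true, iff_false, true_iff, false_iff, not_true, if_true, if_false]); all_goals omega
  · exact key {0, 1, 3, 4} 4 (by simp) (by rfl) (by norm_num) (by omega) fun b => by
      have := b.isLt; simp only [xO, decide_eq_false_iff_not, decide_eq_true_eq, Nat.reduceEqDiff, mem_insert,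
        mem_singleton, notMem_empty]; (try simp only [false_or, or_false, false_and, and_false, true_or, or_true, true_and, and_true, not_false_eq_true, not_true_eq_false, iff_true, iff_false, true_iff, false_iff, not_true, if_true, if_false]); all_goals omega

/-- the sign of cell `(i, j)`: `(edgesIn + wtAnd / 2) mod 2 = sgO i j` (`n` odd, `n ≥ 7`). -/
theorem sign_vO (hn : 7 ≤ n) (h2 : n % 2 = 1) {i j : ℕ} (hi : i < 3) (hj : j < 3) :
    ((edgesIn (vO n i j) + wtAnd (xO n i j) (vO n i j) / 2 : ℕ) : ZMod 2) = sgO i j := by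
  have hw : ∀ (T : Finset ℕ) (c : ℕ), (∀ t ∈ T, t < 6) → T.card = c →
      (∀ b : Fin n, (xO n i j b = true ∧ vO n i j b = true) ↔ b.val ∈ T) → wtAnd (xO n i j) (vO n i j) = c :=
    fun T c hT hc h => (card_filter_eq_of_iff T (fun t ht => by have := hT t ht; omega) _ h).trans hc
  have he : ∀ (T : Finset ℕ) (c : ℕ), (∀ t ∈ T, t < 6) → T.card = c →
      (∀ b : Fin n, (vO n i j b = true ∧ vO n i j (nxt b) = true) ↔ b.val ∈ T) → edgesIn (vO n i j) = c :=
    fun T c hT hc h => (card_filter_eq_of_iff T (fun t ht => by have := hT t ht; omega) _ h).trans hc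
  have hc : ∀ (T : Finset ℕ) (c : ℕ), (∀ t ∈ T, t < 6) → T.card = c →
      (∀ b : Fin n, (vO n i j b = true ∧ vO n i j (nxt b) = true) ↔ b.val ∉ T) → edgesIn (vO n i j) = n - c :=
    fun T c hT hc h => (card_filter_eq_sub_of_iff T (fun t ht => by have := hT t ht; omega) _ h).trans (by rw [hc])
  have hodd : ∀ m : ℕ, m % 2 = 1 → ((m : ℕ) : ZMod 2) = 1 := fun m hm => ZMod.natCast_eq_one_iff_odd.2 (Nat.odd_iff.2 hm)
  have heven : ∀ m : ℕ, m % 2 = 0 → ((m : ℕ) : ZMod 2) = 0 := fun m hm => ZMod.natCast_eq_zero_iff_even.2 (Nat.even_iff.2 hm)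
  interval_cases i <;> interval_cases j
  · rw [show sgO 0 0 = 1 from rfl, hc ∅ 0 (by simp) (by rfl) (fun b => by
        have := b.isLt; simp only [vO, Bool.or_eq_true, Bool.and_eq_true, decide_eq_true_eq, ne_eq, decide_eq_decide, prv_val, nxt_val, Nat.reduceEqDiff, mem_insert, mem_singleton, notMem_empty]; (try simp only [false_or, or_false, false_and, and_false, true_or, or_true, true_and, and_true, not_false_eq_true, not_true_eq_false, iff_true, iff_false, true_iff, false_iff, not_true, if_true, if_false]); all_goals first | omega | (split_ifs <;> (try simp only [false_or, or_false, false_and, and_false, true_or, or_true, true_and, and_true, not_false_eq_true, not_true_eq_false, iff_true, iff_false, true_iff, false_iff, not_true, if_true, if_false]) <;> omega)),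
      hw ∅ 0 (by simp) (by rfl) (fun b => by
        have := b.isLt; simp only [xO, vO, Bool.or_eq_true, Bool.and_eq_true, decide_eq_true_eq, ne_eq, decide_eq_decide, prv_val, nxt_val, Nat.reduceEqDiff, mem_insert, mem_singleton, notMem_empty]; (try simp only [false_or, or_false, false_and, and_false, true_or, or_true, true_and, and_true, not_false_eq_true, not_true_eq_false, iff_true, iff_false, true_iff, false_iff, not_true, if_true, if_false]); all_goals first | omega | (split_ifs <;> (try simp only [false_or, or_false, false_and, and_false, true_or, or_true, true_and, and_true, not_false_eq_true, not_true_eq_false, iff_true, iff_false, true_iff, false_iff, not_true, if_true, if_false]) <;> omega))]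
    exact hodd _ (by omega)
  · rw [show sgO 0 1 = 0 from rfl, he {4} 1 (by simp) (by rfl) (fun b => by
        have := b.isLt; simp only [vO, Bool.or_eq_true, Bool.and_eq_true, decide_eq_true_eq, ne_eq, decide_eq_decide, prv_val, nxt_val, Nat.reduceEqDiff, mem_insert, mem_singleton, notMem_empty]; (try simp only [false_or, or_false, false_and, and_false, true_or, or_true, true_and, and_true, not_false_eq_true, not_true_eq_false, iff_true, iff_false, true_iff, false_iff, not_true, if_true, if_false]); all_goals first | omega | (split_ifs <;> (try simp only [false_or, or_false, false_and, and_false, true_or, or_true, true_and, and_true, not_false_eq_true, not_true_eq_false, iff_true, iff_false, true_iff, false_iff, not_true, if_true, if_false]) <;> omega)),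
      hw {4, 5} 2 (by simp) (by rfl) (fun b => by
        have := b.isLt; simp only [xO, vO, Bool.or_eq_true, Bool.and_eq_true, decide_eq_true_eq, ne_eq, decide_eq_decide, prv_val, nxt_val, Nat.reduceEqDiff, mem_insert, mem_singleton, notMem_empty]; (try simp only [false_or, or_false, false_and, and_false, true_or, or_true, true_and, and_true, not_false_eq_true, not_true_eq_false, iff_true, iff_false, true_iff, false_iff, not_true, if_true, if_false]); all_goals first | omega | (split_ifs <;> (try simp only [false_or, or_false, false_and, and_false, true_or, or_true, true_and, and_true, not_false_eq_true, not_true_eq_false, iff_true, iff_false, true_iff, false_iff, not_true, if_true, if_false]) <;> omega))]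
    exact heven _ (by omega)
  · rw [show sgO 0 2 = 0 from rfl, he {3} 1 (by simp) (by rfl) (fun b => by
        have := b.isLt; simp only [vO, Bool.or_eq_true, Bool.and_eq_true, decide_eq_true_eq, ne_eq, decide_eq_decide, prv_val, nxt_val, Nat.reduceEqDiff, mem_insert, mem_singleton, notMem_empty]; (try simp only [false_or, or_false, false_and, and_false, true_or, or_true, true_and, and_true, not_false_eq_true, not_true_eq_false, iff_true, iff_false, true_iff, false_iff, not_true, if_true, if_false]); all_goals first | omega | (split_ifs <;> (try simp only [false_or, or_false, false_and, and_false, true_or, or_true, true_and, and_true, not_false_eq_true, not_true_eq_false, iff_true, iff_false, true_iff, false_iff, not_true, if_true, if_false]) <;> omega)),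
      hw {3, 4} 2 (by simp) (by rfl) (fun b => by
        have := b.isLt; simp only [xO, vO, Bool.or_eq_true, Bool.and_eq_true, decide_eq_true_eq, ne_eq, decide_eq_decide, prv_val, nxt_val, Nat.reduceEqDiff, mem_insert, mem_singleton, notMem_empty]; (try simp only [false_or, or_false, false_and, and_false, true_or, or_true, true_and, and_true, not_false_eq_true, not_true_eq_false, iff_true, iff_false, true_iff, false_iff, not_true, if_true, if_false]); all_goals first | omega | (split_ifs <;> (try simp only [false_or, or_false, false_and, and_false, true_or, or_true, true_and, and_true, not_false_eq_true, not_true_eq_false, iff_true, iff_false, true_iff, false_iff, not_true, if_true, if_false]) <;> omega))]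
    exact heven _ (by omega)
  · rw [show sgO 1 0 = 0 from rfl, he {1} 1 (by simp) (by rfl) (fun b => by
        have := b.isLt; simp only [vO, Bool.or_eq_true, Bool.and_eq_true, decide_eq_true_eq, ne_eq, decide_eq_decide, prv_val, nxt_val, Nat.reduceEqDiff, mem_insert, mem_singleton, notMem_empty]; (try simp only [false_or, or_false, false_and, and_false, true_or, or_true, true_and, and_true, not_false_eq_true, not_true_eq_false, iff_true, iff_false, true_iff, false_iff, not_true, if_true, if_false]); all_goals first | omega | (split_ifs <;> (try simp only [false_or, or_false, false_and, and_false, true_or, or_true, true_and, and_true, not_false_eq_true, not_true_eq_false, iff_true, iff_false, true_iff, false_iff, not_true, if_true, if_false]) <;> omega)),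
      hw {1, 2} 2 (by simp) (by rfl) (fun b => by
        have := b.isLt; simp only [xO, vO, Bool.or_eq_true, Bool.and_eq_true, decide_eq_true_eq, ne_eq, decide_eq_decide, prv_val, nxt_val, Nat.reduceEqDiff, mem_insert, mem_singleton, notMem_empty]; (try simp only [false_or, or_false, false_and, and_false, true_or, or_true, true_and, and_true, not_false_eq_true, not_true_eq_false, iff_true, iff_false, true_iff, false_iff, not_true, if_true, if_false]); all_goals first | omega | (split_ifs <;> (try simp only [false_or, or_false, false_and, and_false, true_or, or_true, true_and, and_true, not_false_eq_true, not_true_eq_false, iff_true, iff_false, true_iff, false_iff, not_true, if_true, if_false]) <;> omega))]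
    exact heven _ (by omega)
  · rw [show sgO 1 1 = 0 from rfl, hc {1, 2, 3, 4} 4 (by simp) (by rfl) (fun b => by
        have := b.isLt; simp only [vO, Bool.or_eq_true, Bool.and_eq_true, decide_eq_true_eq, ne_eq, decide_eq_decide, prv_val, nxt_val, Nat.reduceEqDiff, mem_insert, mem_singleton, notMem_empty]; (try simp only [false_or, or_false, false_and, and_false, true_or, or_true, true_and, and_true, not_false_eq_true, not_true_eq_false, iff_true, iff_false, true_iff, false_iff, not_true, if_true, if_false]); all_goals first | omega | (split_ifs <;> (try simp only [false_or, or_false, false_and, and_false, true_or, or_true, true_and, and_true, not_false_eq_true, not_true_eq_false, iff_true, iff_false, true_iff, false_iff, not_true, if_true, if_false]) <;> omega)),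
      hw {1, 5} 2 (by simp) (by rfl) (fun b => by
        have := b.isLt; simp only [xO, vO, Bool.or_eq_true, Bool.and_eq_true, decide_eq_true_eq, ne_eq, decide_eq_decide, prv_val, nxt_val, Nat.reduceEqDiff, mem_insert, mem_singleton, notMem_empty]; (try simp only [false_or, or_false, false_and, and_false, true_or, or_true, true_and, and_true, not_false_eq_true, not_true_eq_false, iff_true, iff_false, true_iff, false_iff, not_true, if_true, if_false]); all_goals first | omega | (split_ifs <;> (try simp only [false_or, or_false, false_and, and_false, true_or, or_true, true_and, and_true, not_false_eq_true, not_true_eq_false, iff_true, iff_false, true_iff, false_iff, not_true, if_true, if_false]) <;> omega))]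
    exact heven _ (by omega)
  · rw [show sgO 1 2 = 0 from rfl, he {2} 1 (by simp) (by rfl) (fun b => by
        have := b.isLt; simp only [vO, Bool.or_eq_true, Bool.and_eq_true, decide_eq_true_eq, ne_eq, decide_eq_decide, prv_val, nxt_val, Nat.reduceEqDiff, mem_insert, mem_singleton, notMem_empty]; (try simp only [false_or, or_false, false_and, and_false, true_or, or_true, true_and, and_true, not_false_eq_true, not_true_eq_false, iff_true, iff_false, true_iff, false_iff, not_true, if_true, if_false]); all_goals first | omega | (split_ifs <;> (try simp only [false_or, or_false, false_and, and_false, true_or, or_true, true_and, and_true, not_false_eq_true, not_true_eq_false, iff_true, iff_false, true_iff, false_iff, not_true, if_true, if_false]) <;> omega)),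
      hw {2, 3} 2 (by simp) (by rfl) (fun b => by
        have := b.isLt; simp only [xO, vO, Bool.or_eq_true, Bool.and_eq_true, decide_eq_true_eq, ne_eq, decide_eq_decide, prv_val, nxt_val, Nat.reduceEqDiff, mem_insert, mem_singleton, notMem_empty]; (try simp only [false_or, or_false, false_and, and_false, true_or, or_true, true_and, and_true, not_false_eq_true, not_true_eq_false, iff_true, iff_false, true_iff, false_iff, not_true, if_true, if_false]); all_goals first | omega | (split_ifs <;> (try simp only [false_or, or_false, false_and, and_false, true_or, or_true, true_and, and_true, not_false_eq_true, not_true_eq_false, iff_true, iff_false, true_iff, false_iff, not_true, if_true, if_false]) <;> omega))]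
    exact heven _ (by omega)
  · rw [show sgO 2 0 = 0 from rfl, he {0} 1 (by simp) (by rfl) (fun b => by
        have := b.isLt; simp only [vO, Bool.or_eq_true, Bool.and_eq_true, decide_eq_true_eq, ne_eq, decide_eq_decide, prv_val, nxt_val, Nat.reduceEqDiff, mem_insert, mem_singleton, notMem_empty]; (try simp only [false_or, or_false, false_and, and_false, true_or, or_true, true_and, and_true, not_false_eq_true, not_true_eq_false, iff_true, iff_false, true_iff, false_iff, not_true, if_true, if_false]); all_goals first | omega | (split_ifs <;> (try simp only [false_or, or_false, false_and, and_false, true_or, or_true, true_and, and_true, not_false_eq_true, not_true_eq_false, iff_true, iff_false, true_iff, false_iff, not_true, if_true, if_false]) <;> omega)),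
      hw {0, 1} 2 (by simp) (by rfl) (fun b => by
        have := b.isLt; simp only [xO, vO, Bool.or_eq_true, Bool.and_eq_true, decide_eq_true_eq, ne_eq, decide_eq_decide, prv_val, nxt_val, Nat.reduceEqDiff, mem_insert, mem_singleton, notMem_empty]; (try simp only [false_or, or_false, false_and, and_false, true_or, or_true, true_and, and_true, not_false_eq_true, not_true_eq_false, iff_true, iff_false, true_iff, false_iff, not_true, if_true, if_false]); all_goals first | omega | (split_ifs <;> (try simp only [false_or, or_false, false_and, and_false, true_or, or_true, true_and, and_true, not_false_eq_true, not_true_eq_false, iff_true, iff_false, true_iff, false_iff, not_true, if_true, if_false]) <;> omega))]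
    exact heven _ (by omega)
  · rw [show sgO 2 1 = 0 from rfl, he {1, 2, 3} 3 (by simp) (by rfl) (fun b => by
        have := b.isLt; simp only [vO, Bool.or_eq_true, Bool.and_eq_true, decide_eq_true_eq, ne_eq, decide_eq_decide, prv_val, nxt_val, Nat.reduceEqDiff, mem_insert, mem_singleton, notMem_empty]; (try simp only [false_or, or_false, false_and, and_false, true_or, or_true, true_and, and_true, not_false_eq_true, not_true_eq_false, iff_true, iff_false, true_iff, false_iff, not_true, if_true, if_false]); all_goals first | omega | (split_ifs <;> (try simp only [false_or, or_false, false_and, and_false, true_or, or_true, true_and, and_true, not_false_eq_true, not_true_eq_false, iff_true, iff_false, true_iff, false_iff, not_true, if_true, if_false]) <;> omega)),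
      hw {1, 4} 2 (by simp) (by rfl) (fun b => by
        have := b.isLt; simp only [xO, vO, Bool.or_eq_true, Bool.and_eq_true, decide_eq_true_eq, ne_eq, decide_eq_decide, prv_val, nxt_val, Nat.reduceEqDiff, mem_insert, mem_singleton, notMem_empty]; (try simp only [false_or, or_false, false_and, and_false, true_or, or_true, true_and, and_true, not_false_eq_true, not_true_eq_false, iff_true, iff_false, true_iff, false_iff, not_true, if_true, if_false]); all_goals first | omega | (split_ifs <;> (try simp only [false_or, or_false, false_and, and_false, true_or, or_true, true_and, and_true, not_false_eq_true, not_true_eq_false, iff_true, iff_false, true_iff, false_iff, not_true, if_true, if_false]) <;> omega))]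
    exact heven _ (by omega)
  · rw [show sgO 2 2 = 0 from rfl, hc {0, 1, 2, 3} 4 (by simp) (by rfl) (fun b => by
        have := b.isLt; simp only [vO, Bool.or_eq_true, Bool.and_eq_true, decide_eq_true_eq, ne_eq, decide_eq_decide, prv_val, nxt_val, Nat.reduceEqDiff, mem_insert, mem_singleton, notMem_empty]; (try simp only [false_or, or_false, false_and, and_false, true_or, or_true, true_and, and_true, not_false_eq_true, not_true_eq_false, iff_true, iff_false, true_iff, false_iff, not_true, if_true, if_false]); all_goals first | omega | (split_ifs <;> (try simp only [false_or, or_false, false_and, and_false, true_or, or_true, true_and, and_true, not_false_eq_true, not_true_eq_false, iff_true, iff_false, true_iff, false_iff, not_true, if_true, if_false]) <;> omega)),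
      hw {0, 4} 2 (by simp) (by rfl) (fun b => by
        have := b.isLt; simp only [xO, vO, Bool.or_eq_true, Bool.and_eq_true, decide_eq_true_eq, ne_eq, decide_eq_decide, prv_val, nxt_val, Nat.reduceEqDiff, mem_insert, mem_singleton, notMem_empty]; (try simp only [false_or, or_false, false_and, and_false, true_or, or_true, true_and, and_true, not_false_eq_true, not_true_eq_false, iff_true, iff_false, true_iff, false_iff, not_true, if_true, if_false]); all_goals first | omega | (split_ifs <;> (try simp only [false_or, or_false, false_and, and_false, true_or, or_true, true_and, and_true, not_false_eq_true, not_true_eq_false, iff_true, iff_false, true_iff, false_iff, not_true, if_true, if_false]) <;> omega))]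
    exact heven _ (by omega)

/-- COLUMN LAW (odd `n`): at every position `b ≥ 3` the three kernel vectors of column `j` have even sum. -/
theorem colO {j : ℕ} (hj : j < 3) (b : Fin n) (hb : 3 ≤ b.val) :
    (xor (xor (vO n 0 j b) (vO n 1 j b)) (vO n 2 j b)) = false := by
  have hlt := b.isLt
  rw [xor3_false_iff]
  interval_cases j <;> simp only [vO, Bool.or_eq_true, Bool.and_eq_true, decide_eq_true_eq, ne_eq, decide_eq_decide, prv_val, nxt_val, Nat.reduceEqDiff, mem_insert, mem_singleton, notMem_empty] <;> (try simp only [false_or, or_false, false_and, and_false, true_or, or_true, true_and, and_true, not_false_eq_true, not_true_eq_false, iff_true, iff_false, true_iff, false_iff, not_true, if_true, if_false]) <;> omega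

/-- ROW LAW (odd `n`): at every position `b ∉ {3,4,5}` the three kernel vectors of row `i` have even sum. -/
theorem rowO {i : ℕ} (hi : i < 3) (b : Fin n) (hb : b.val < 3 ∨ 6 ≤ b.val) :
    (xor (xor (vO n i 0 b) (vO n i 1 b)) (vO n i 2 b)) = false := by
  have hlt := b.isLt
  rw [xor3_false_iff]
  interval_cases i <;> simp only [vO, Bool.or_eq_true, Bool.and_eq_true, decide_eq_true_eq, ne_eq, decide_eq_decide, prv_val, nxt_val, Nat.reduceEqDiff, mem_insert, mem_singleton, notMem_empty] <;> (try simp only [false_or, or_false, false_and, and_false, true_or, or_true, true_and, and_true, not_false_eq_true, not_true_eq_false, iff_true, iff_false, true_iff, false_iff, not_true, if_true, if_false]) <;> omega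

/-- the column-`j` inputs agree at positions `≥ 3`: the `i`-domino lives on `{0,1,2}`. -/
theorem xO_agree_on (i j : ℕ) (b : Fin n) (hb : 3 ≤ b.val) : xO n i j b = xO n 0 j b := by
  simp only [xO]; rw [decide_eq_decide]; omega

/-- the row-`i` inputs agree at positions `< 3` or `≥ 6`: the `j`-pattern lives on `{3,4,5}`. -/
theorem xO_agree_off (i j : ℕ) (b : Fin n) (hb : b.val < 3 ∨ 6 ≤ b.val) : xO n i j b = xO n i 0 b := by
  simp only [xO]; rw [decide_eq_decide]; omega

/-- SIGN LAW (odd `n`): the nine signs sum to `1`. -/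
theorem sgO_sum : (∑ i : Fin 3, ∑ j : Fin 3, sgO i j) = 1 := by
  simp only [Fin.sum_univ_three, Fin.val_zero, Fin.val_one, Fin.val_two]; decide

/-- ★ THE ODD MAGIC SQUARE: for odd `n ≥ 7`, a strategy map that is bipartite-local for a bipartition facing `3|3` in
the frame rotated by `m` loses the ring game on one of the nine rotated odd-class inputs `rot m (xO n i j)`. -/
theorem magicO_at (hn : 7 ≤ n) (h2 : n % 2 = 1) (m : ℕ) {S : Finset (Fin n)} (hS : Faces33At m S)
    {z : (Fin n → Bool) → Fin n → Bool} (hz : BiLocal S z) :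
    ∃ i j : ℕ, i < 3 ∧ j < 3 ∧ OddZeros (rot m (xO n i j)) ∧ ¬ Rel (rot m (xO n i j)) (z (rot m (xO n i j))) := by
  obtain ⟨i, j, hi, hj, h⟩ := magic_of_square hz (fun i j => rot m (xO n i j)) (fun i j => rot m (vO n i j)) sgO
    (fun i j hi hj => (inKernel_rot m _ _).2 (inKernel_vO hn h2 hi hj))
    (fun i j hi hj => by simp only [edgesIn_rot, wtAnd_rot]; exact sign_vO hn h2 hi hj) sgO_sum
    (fun j hj b hb => by simp only [rot_apply]; exact colO hj _ (hS.three_le hb))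
    (fun i hi b hb => by simp only [rot_apply]; exact rowO hi _ (hS.off hb))
    (fun i j b hb => by simp only [rot_apply]; exact xO_agree_on i j _ (hS.three_le hb))
    (fun i j b hb => by simp only [rot_apply]; exact xO_agree_off i j _ (hS.off hb))
  exact ⟨i, j, hi, hj, (oddZeros_rot m _).2 (oddZeros_xO hn h2 hi hj), h⟩


end Summit.QuantumAdvantage.QuantumAdvantage.Theorems.CutDial
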